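import Summits.AtomisticToContinuum.Crystallization.Theorems.ChartedZeroExcessLayeredLatticeLiouvilleXR

/-!
# Zero-excess layered lattice Liouville — part XS (lens-2 g59, node «SBGlueC4g»): the LOCAL CLAIM for the original registration

Critic rows 1133/1135 (C3/C4 «the final claim is about `Ψ₀`, every `x ∈ S`, every `ρ ≥ ρ₀`; large-`ρ` regime explicit»), leaf (2)
`SubWindowBudgetGlueBPG` of `stmt-AtomisticToContinuum-26636`.

Given the tower hypotheses `TH K S Ψ₀ st₀ x X₀` (XO) — in particular NO fatness and NO tameness hypothesis — the ORIGINAL registration `Ψ₀`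
satisfies, for every `ρ ≥ max(nlo, 21)` with `S ∩ ball x ρ ⊆ ball 0 (8R)`,
`bondEnergy (S ∩ ball x ρ) (p ↦ p − Ψ₀ p) ≤ K.ABK · nK(S ∩ ball x ρ)` (★ `TH.final`), where `K.ABK` (`SBK.ABK`) is an explicit polynomial in
`pmax = P₀ + G₀/nlo²`, `μM²`, `C_g η` and the constants `c₀, C₁, δ, t_C, K_R` (part D makes `P₀, G₀, μM²` multiples of `C_g η`, so that
`K.ABK = AB·η`).
* REGIME (i) `(2ρ+8)(8/c₀) ≤ n₀`: the deepest level `i` of the tower (XR `TH.tower`) whose ball `B_{n_i}` still covers the index shadow of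
  `S ∩ ball x ρ` (XP `exists_last_le`; then `n_i ≤ ((24/c₀+1)/t_C)·ρ`); XL `bondEnergy_disp_iterate_le_of_cover` between the charts `i → 0` with the
  total drift `D_i ≤ 2μM`, the level profile `E(φ_i)(B_{n_i}) ≤ p_i·#B ≤ pmax·#B`, and the mass bound XL `ncard_idxBall_le_mass`.
* REGIME (ii) `n₀ < (2ρ+8)(8/c₀)` (so `8R < 192 K_R ρ/c₀`): XL `bondEnergy_disp_le_of_isGlobalReg` at `D = 8R` and XL `nK_atomsIn_le_mass`.
-/

noncomputable section

open scoped BigOperators InnerProductSpace RealInnerProductSpace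
open Set Function Metric
open Summit.AtomisticToContinuum.Crystallization.Theorems.ChartedPlanarOrderRigidityDoor (E3 IsClean IsNash atomsIn)
open Summit.AtomisticToContinuum.Crystallization.Theorems.ChartedPlanarOrderDensityDichotomy (μS IsSep nK nK_nonneg)
open Summit.AtomisticToContinuum.Crystallization.Theorems.ChartedPlanarOrderCleanScaleP (IsCleanP IsDoorSetP isCleanP_one_iff)
open Summit.AtomisticToContinuum.Crystallization.Theorems.ChartedPlanarOrderMesoCut (LayeredHom)
open Summit.AtomisticToContinuum.Crystallization.Theorems.ChartedPlanarOrderDoorLayered (Layered layeredHom_eq_layered atomsIn_subset)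
open Summit.AtomisticToContinuum.Crystallization.Theorems.ChartedPlanarOrderDoorLayeredOsc (IsTwoShellAffineGood)

namespace Summit.AtomisticToContinuum.Crystallization.Theorems.ChartedZeroExcessLayeredLatticeLiouville

namespace SBK

/-- the energy constant of the local claim at the `K`-level (module docstring). -/
def ABK (K : SBK) : ℝ :=
  dictA K.c₀ 8 * (27 * (336 * K.C₁ * ((24 / K.c₀ + 1) / K.tC) / 25) ^ 3) * (2 * K.pmax + 54 * (2 * K.μM) ^ 2) +
    2 * (10 / K.δ + 1) ^ 3 * (8 * K.Cg * K.η) * ((2 * (192 * K.KR / K.c₀ + 1) / K.δ + 1 / 21) * (336 * K.C₁ / 25)) ^ 3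

/-- `ABK_nonneg` (docstring added by the landing lane; see the module docstring). [formal bookkeeping] -/
theorem ABK_nonneg {K : SBK} (hK : K.OK) : 0 ≤ K.ABK := by
  unfold ABK
  have := hK.hμM; have := pmax_nonneg hK; have := dictA_nonneg K.c₀ 8; have := hK.hCg; have := hK.hη; have := hK.hKR; have := hK.hδ
  have := hK.hc₀; have := C₁_pos hK; have := hK.htC
  positivity

/-- some level of the ladder lies below `nlo` (`t_C < 1`). -/
theorem exists_n_lt_nlo {K : SBK} (hK : K.OK) : ∃ ℓ : ℕ, K.n ℓ < K.nlo := by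
  obtain ⟨k, hk⟩ := exists_pow_lt_of_lt_one (show 0 < K.nlo / K.n0 from div_pos (nlo_pos hK) (n0_pos hK))
    (show K.tC < 1 by linarith [hK.htC2])
  refine ⟨k, ?_⟩
  rw [lt_div_iff₀ (n0_pos hK)] at hk
  show K.n0 * K.tC ^ k < K.nlo
  linarith

end SBK

section Final

variable {K : SBK} {S : Set E3} {Ψ₀ : E3 → E3} {st₀ : Lev} {x : E3} {X₀ : Cell 2 × ℤ}

/-! ### XS.1  Regime (i) at a covering level -/

/-- the ORIGINAL registration's local energy on `S ∩ ball x ρ`, priced through ANY level `ℓ` of the tower whose ball covers the index shadow: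
`≤ dictA(c₀,8)·(2·pmax + 54·(2μM)²)·#B_{n_ℓ}`. -/
theorem TowerInv.local_le (T : TH K S Ψ₀ st₀ x X₀) {ℓ : ℕ} {lev : ℕ → Lev} (hT : TowerInv K S Ψ₀ st₀ X₀ ℓ lev) (hℓ : K.nlo ≤ K.n ℓ)
    {ρ : ℝ} (hρ : 0 ≤ ρ) (hn : (2 * ρ + 8) * (8 / K.c₀) ≤ K.n ℓ) :
    bondEnergy (S ∩ ball x ρ) (fun p => p - Ψ₀ p) ≤ dictA K.c₀ 8 * (2 * K.pmax + 54 * (2 * K.μM) ^ 2) * ((idxBall X₀ (K.n ℓ)).ncard : ℝ) := by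
  have hK := T.ok
  have hOℓ := hT.levOK ℓ le_rfl
  obtain ⟨-, -, -, -, hcpos, hD2, -⟩ := hOℓ.floors T hℓ
  obtain ⟨hlip0, -⟩ := hT.lip ℓ le_rfl 0 (Nat.zero_le ℓ)
  rw [hT.zero, T.D₀, sub_zero] at hlip0
  have hΔ := isIdxLipschitz_sub_symm hlip0
  have h := bondEnergy_disp_iterate_le_of_cover T.cleanP T.bij₀ T.c₀_pos T.cryst₀ T.fwd₀ T.hδ T.sep hcpos hOℓ.cryst T.c₀_pos T.cryst₀ hΔ
    X₀ hρ hn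
  rw [T.hX₀, ← levφ_def, ← bondEnergy_disp_self_eq T.bij₀ inter_subset_left] at h
  have hN : 0 ≤ ((idxBall X₀ (K.n ℓ)).ncard : ℝ) := by positivity
  have hdA : 0 ≤ dictA K.c₀ 8 := dictA_nonneg _ _
  have hE : idxEnergy (levφ S Ψ₀ st₀ (lev ℓ)) (idxBall X₀ (K.n ℓ)) ≤ K.pmax * ((idxBall X₀ (K.n ℓ)).ncard : ℝ) :=
    hOℓ.energy.trans (mul_le_mul_of_nonneg_right (SBK.p_le_pmax hK hℓ) hN)
  have hDsq : (lev ℓ).D ^ 2 ≤ (2 * K.μM) ^ 2 := pow_le_pow_left₀ hOℓ.D0 hD2 2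
  have hD' : 54 * (lev ℓ).D ^ 2 * ((idxBall X₀ (K.n ℓ)).ncard : ℝ) ≤ 54 * (2 * K.μM) ^ 2 * ((idxBall X₀ (K.n ℓ)).ncard : ℝ) :=
    mul_le_mul_of_nonneg_right (by linarith) hN
  calc _ ≤ _ := h
    _ ≤ dictA K.c₀ 8 * (2 * (K.pmax * ((idxBall X₀ (K.n ℓ)).ncard : ℝ)) + 54 * (2 * K.μM) ^ 2 * ((idxBall X₀ (K.n ℓ)).ncard : ℝ)) :=
        mul_le_mul_of_nonneg_left (by linarith) hdA
    _ = _ := by ring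

/-! ### XS.2  The local claim -/

/-- ★ the LOCAL CLAIM for the original registration (module docstring). [this file, g59] -/
theorem TH.final (T : TH K S Ψ₀ st₀ x X₀) {ρ : ℝ} (hρ1 : K.nlo ≤ ρ) (hρ2 : 21 ≤ ρ) (hsub : S ∩ ball x ρ ⊆ ball 0 (8 * K.R)) :
    bondEnergy (S ∩ ball x ρ) (fun p => p - Ψ₀ p) ≤ K.ABK * nK (S ∩ ball x ρ) := by
  have hK := T.ok
  have hc₀ := hK.hc₀; have htC := hK.htC; have hC₁ := SBK.C₁_pos hK; have hδ := hK.hδ; have hCg := hK.hCg; have hη := hK.hη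
  have hKR := hK.hKR; have hR := hK.hR; have hμM := hK.hμM; have hpmax := SBK.pmax_nonneg hK
  have hN : 0 ≤ nK (S ∩ ball x ρ) := nK_nonneg _
  have hdA : 0 ≤ dictA K.c₀ 8 := dictA_nonneg _ _
  set M1 : ℝ := dictA K.c₀ 8 * (27 * (336 * K.C₁ * ((24 / K.c₀ + 1) / K.tC) / 25) ^ 3) * (2 * K.pmax + 54 * (2 * K.μM) ^ 2) with hM1
  set M2 : ℝ := 2 * (10 / K.δ + 1) ^ 3 * (8 * K.Cg * K.η) * ((2 * (192 * K.KR / K.c₀ + 1) / K.δ + 1 / 21) * (336 * K.C₁ / 25)) ^ 3 with hM2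
  have hM1' : 0 ≤ M1 := by positivity
  have hM2' : 0 ≤ M2 := by positivity
  have hAB : K.ABK = M1 + M2 := rfl
  rw [hAB]
  have h24 : (2 * ρ + 8) * (8 / K.c₀) ≤ 24 / K.c₀ * ρ := by
    rw [show 24 / K.c₀ * ρ = (3 * ρ) * (8 / K.c₀) by ring]
    exact mul_le_mul_of_nonneg_right (by linarith) (by positivity)
  rcases le_or_gt ((2 * ρ + 8) * (8 / K.c₀)) K.n0 with hcase | hcase
  · -- REGIME (i): the deepest covering level of the tower
    obtain ⟨ℓb, hℓb⟩ := SBK.exists_n_lt_nlo hK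
    have hP0 : (fun i : ℕ => (2 * ρ + 8) * (8 / K.c₀) ≤ K.n i ∧ K.nlo ≤ K.n i) 0 := by
      show (2 * ρ + 8) * (8 / K.c₀) ≤ K.n 0 ∧ K.nlo ≤ K.n 0
      rw [SBK.n_zero]; exact ⟨hcase, hK.hn0lo⟩
    obtain ⟨i, -, ⟨hcov, hnlo⟩, hlast⟩ :=
      exists_last_le (P := fun i : ℕ => (2 * ρ + 8) * (8 / K.c₀) ≤ K.n i ∧ K.nlo ≤ K.n i) hP0 ℓb
    have hnot : ¬ ((2 * ρ + 8) * (8 / K.c₀) ≤ K.n (i + 1) ∧ K.nlo ≤ K.n (i + 1)) := by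
      rcases hlast with h | h
      · subst h; exact absurd hnlo (not_le.mpr hℓb)
      · exact h
    have hA : K.n i ≤ (24 / K.c₀ + 1) / K.tC * ρ := by
      rw [SBK.n_succ] at hnot
      have hb : K.tC * K.n i ≤ (24 / K.c₀ + 1) * ρ := by
        have : 0 ≤ 24 / K.c₀ * ρ := by positivity
        rcases not_and_or.mp hnot with h | h
        · have := not_le.mp h; nlinarith
        · have := not_le.mp h; nlinarith
      rw [div_mul_eq_mul_div, le_div_iff₀ htC]
      linarith
    obtain ⟨lev, hT⟩ := T.tower i hnlo
    have h1 := hT.local_le T hnlo (by linarith) hcov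
    have h2 := ncard_idxBall_le_mass T.bij₀ T.iso T.clean₀ T.tame₀ T.c₀_pos T.cryst₀ T.hδ T.sep hC₁ X₀ hρ2 (SBK.one_le_n hK hnlo) hA
    rw [T.hX₀] at h2
    have h0 : 0 ≤ dictA K.c₀ 8 * (2 * K.pmax + 54 * (2 * K.μM) ^ 2) := by positivity
    have h3 := mul_le_mul_of_nonneg_left h2 h0
    have hM2N : 0 ≤ M2 * nK (S ∩ ball x ρ) := mul_nonneg hM2' hN
    calc _ ≤ _ := h1
      _ ≤ _ := h3
      _ = M1 * nK (S ∩ ball x ρ) := by rw [hM1]; ring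
      _ ≤ (M1 + M2) * nK (S ∩ ball x ρ) := by linarith
  · -- REGIME (ii): the top registration on the root window `8R`
    have hsub' : S ∩ ball x ρ ⊆ atomsIn (μS S) 0 (8 * K.R) := by
      intro p hp
      rw [mem_atomsIn_iff]
      have h := hsub hp
      rw [mem_ball_zero_iff] at h
      exact ⟨hp.1, h.le⟩
    have h1 := bondEnergy_disp_le_of_isGlobalReg T.bij₀ T.c₀_pos T.cryst₀ T.hδ T.sep T.reg' (by linarith : K.R ≤ 8 * K.R) hsub'
    have h8 : 8 * K.R / K.R = 8 := by field_simp
    rw [h8] at h1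
    have hB : 8 * K.R + 1 ≤ (192 * K.KR / K.c₀ + 1) * ρ := by
      have hlt : K.R < K.KR * (24 / K.c₀ * ρ) := by
        have h := lt_of_lt_of_le hcase h24
        have e : K.n0 = K.R / K.KR := rfl
        rw [e, div_lt_iff₀ hKR] at h
        linarith
      have e2 : (192 * K.KR / K.c₀ + 1) * ρ = 8 * (K.KR * (24 / K.c₀ * ρ)) + ρ := by ring
      rw [e2]; linarith
    have h2 := nK_atomsIn_le_mass T.bij₀ T.iso T.clean₀ T.tame₀ T.c₀_pos T.cryst₀ T.hδ T.sep hC₁ X₀ hρ2 (by positivity : (0 : ℝ) ≤ 8 * K.R) hB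
    rw [T.hX₀] at h2
    have h3 := mul_le_mul_of_nonneg_left h2 (by positivity : 0 ≤ 2 * (10 / K.δ + 1) ^ 3 * (K.Cg * 8 * K.η))
    have hM1N : 0 ≤ M1 * nK (S ∩ ball x ρ) := mul_nonneg hM1' hN
    calc _ ≤ _ := h1
      _ = 2 * (10 / K.δ + 1) ^ 3 * (K.Cg * 8 * K.η) * nK (atomsIn (μS S) 0 (8 * K.R)) := by ring
      _ ≤ _ := h3
      _ = M2 * nK (S ∩ ball x ρ) := by rw [hM2]; ring
      _ ≤ (M1 + M2) * nK (S ∩ ball x ρ) := by linarith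

end Final

end Summit.AtomisticToContinuum.Crystallization.Theorems.ChartedZeroExcessLayeredLatticeLiouville

end
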